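import Literature.Analysis.FluidPDE.SelfSimilar
import HarnessLib

/-!
# Tsai's weighted `L^{5/3}` pressure of a self-similar profile (Tsai 1998, §4): named fact

Analysis/FluidPDE fact file in the decomposition of the named fact
`Literature.Analysis.FluidPDE.tsai1998_lemma41` (`FluidPDE/TsaiLocalEnergy`; T.-P. Tsai, *On
Leray's self-similar solutions of the Navier–Stokes equations satisfying local energy
estimates*, Arch. Rational Mech. Anal. 143 (1998) 29–51, **Lemma 4.1**, p. 46: a self-similar
weak solution `u = λ(t) U(λ(t) x)` of Navier–Stokes in `Q₁(0, T)` with the local energy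
estimates (1.4) admits a pressure `p = λ² P̃(λ x)`, `p ∈ L^{5/3}(Q₁)`, making `(u, p)` a suitable
weak solution).

## The printed proof of Lemma 4.1 (pp. 44–46) and the part vendored here

1. (p. 44) By [CKN, p. 781] the local energy estimates (1.4) give `u ∈ L^{10/3}(Q₁)`; the change
   of variables (4.1) turns `‖u‖_{10/3,Q₁}` and `‖∇u‖_{2,Q₁}` into weighted integrals of the
   profile, `∫ |U|^{10/3} A₁ min(|y|^{-5/3}, λ₀^{-5/3}) dy` and `∫ |∇U|² A₂ min(|y|⁻¹, λ₀⁻¹) dy`,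
   which are therefore finite; since `U` is smooth this gives **(4.3)**:
   `∫ |U|^{10/3} w dy < ∞`, `w(y) = |y|^{-5/3}`, an `A_{5/3}` weight on `ℝ³`.
2. (p. 45) "Using the results in [St2, pp. 204–211]" (Stein, *Harmonic Analysis* (1993), Ch. V:
   Calderón–Zygmund operators are bounded on `L^p_w` for `w ∈ A_p`) "the operators `RᵢRⱼ` used
   in (2.2) to define `P̃` are continuous on `L^{5/3}_w(ℝ³)` … Therefore, given `U` satisfying
   (4.3), we can set `P̃ = Σ RᵢRⱼ(UᵢUⱼ)` and we have `‖P̃‖_{w,5/3} ≤ C Σ ‖UᵢUⱼ‖_{w,5/3}`."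
3. (pp. 45–46) "Following the proof of Lemma 2.1, we want to show that `P̃` differs from `P`
   only by a constant": `P̃` solves (2.1) `−ΔP̃ = ∂ᵢ∂ⱼ(UᵢUⱼ)` in `𝒟'`, the vector field
   `F = −νΔU + aU + a(y·∇)U + (U·∇)U + ∇P̃ = ∇P̃ − ∇P` is harmonic, and `D^α F(0) = 0` for every
   `α` by the `ε`-rescaled test-function argument of Lemma 2.1 run with the weighted Hölder
   inequality and (4.3) (displayed on p. 45 for the term `(y·∇)U`); hence `F ≡ 0`, "`P̃`
   together with `U` satisfy Leray's equation (1.3)", i.e. `P − P̃` is constant.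
4. (p. 46) `p := λ² P̃(λx)` (form (1.2)₂) satisfies (1.1) with `u`, and `p ∈ L^{5/3}(Q₁)` since
   `P̃ ∈ L^{5/3}_w` (the change of variables of step 1 with the exponent `5/3`); smooth solutions
   satisfy the generalized energy inequality, so `(u, p)` is suitable.

Steps 1 and 4 and the suitability are elementary (change of variables, the multiplicative
inequality `L^∞L² ∩ L²Ḣ¹ ⊂ L^{10/3}` on dyadic shells, integration by parts for `C²` solutions)
and belong to the proofs layer of `TsaiLocalEnergy` (Mathlib and tree tools suffice: Haar
scaling of Lebesgue measure, `eLpNorm_ten_thirds_le_of_contDiff_euclidean` of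
`MultiplicativeInequality`, the whole-space integrations by parts of `WholeSpaceIBP`). Steps 2–3
are the analytic heart: they rest on the
`A_p`-weighted `L^p` theory of the Riesz transforms (`p = 5/3 ≠ 2`), Weyl's lemma and the
Liouville-type identification of Lemma 2.1, none of which Mathlib or `Literature` has at present
(the tree has only the `L²` theory of `RᵢRⱼ`, `NormalisedPressureL2Bound`, by two integrations by
parts; no Calderón–Zygmund decomposition, no Marcinkiewicz interpolation, no `A_p` weights). They
are vendored here as ONE named fact, `tsai1998_pressure_L53w`, in the form in which Lemma 4.1
consumes them: *the profile pressure `P`, shifted by a suitable constant, lies in `L^{5/3}_w`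
with norm controlled by `‖ |U|² ‖_{w,5/3}`*. The Riesz-transform pressure `P̃` itself is not
needed downstream and is not named in the statement (it is `P − c`; for profiles with
`U ∈ C¹ ∩ L²` it is the tree's `normalisedPressure U` of `FluidPDE/NormalisedPressure`, Tao's
`−Δ⁻¹∂ᵢ∂ⱼ(UᵢUⱼ)`, whose symbol `−ξᵢξⱼ/|ξ|²` is that of `RᵢRⱼ`).

## The profile class

As for the sibling facts of `TsaiGrowthLemmas` and the target `tsai1998_lemma41`, the fact is
stated for the tree's pointwise profile class `IsLerayProfile ν a U P` (`U ∈ C²`, `P ∈ C¹`,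
`−νΔU + aU + a(y·∇)U + (U·∇)U + ∇P = 0`, `div U = 0` pointwise on `ℝ³`; Tsai's `U` is smooth by
elliptic regularity, p. 33, and his `P` is any pressure solving (1.3) with `U` in bounded regions,
p. 34, unique up to a constant — exactly the `P` of an `IsLerayProfile` pair). The argument of
step 3 uses of `U`, `P` only the equation (1.3) in `𝒟'`, the continuity of `F` and (4.3). The
standing hypotheses `ν > 0`, `a > 0` of the paper are kept. The weight is written in `ℝ≥0∞` as
`‖y‖ₑ ^ (-(5/3))` (value `⊤` at the single point `y = 0`, a null set), so that (4.3) reads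
`∫⁻ ‖U y‖ₑ^{10/3} ‖y‖ₑ^{-5/3} < ∞`, and the printed norm bound
`‖P̃‖_{w,5/3} ≤ C Σᵢⱼ ‖UᵢUⱼ‖_{w,5/3}` (with `|UᵢUⱼ| ≤ |U|²`, nine terms) is recorded raised to the
power `5/3`: `∫ |P − c|^{5/3} w ≤ C ∫ |U|^{10/3} w` with an absolute constant `C`.

## Mathlib / tree search

Mathlib (this pin): no Riesz transforms, Calderón–Zygmund operators, Muckenhoupt weights or
Marcinkiewicz interpolation (`lean search` for `[Rr]iesz[ _]?[Tt]ransform`, `Calder[oó]n`,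
`Muckenhoupt`, `Marcinkiewicz`: tree docstrings only). Tree: `IsLerayProfile` (`SelfSimilar`),
`normalisedPressure`, `stein1970_normalisedPressure_eLpNorm_le_holds` (the `L²` bound,
`NormalisedPressureL2Bound`), `tsai1998_profile_smooth`, `tsai1998_lemma32/33`
(`TsaiGrowthLemmas`, the `L^q` twins of this fact for Theorem 1, also named facts).

## References

* T.-P. Tsai, *On Leray's self-similar solutions of the Navier–Stokes equations satisfying local
  energy estimates*, Arch. Rational Mech. Anal. 143 (1998) 29–51: §2, Lemma 2.1 (pp. 34–36);
  §4, (4.1)–(4.3) and the construction of `P̃` (pp. 44–46); Lemma 4.1 (p. 46) [Tsai1998].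
* E. M. Stein, *Harmonic Analysis: real-variable methods, orthogonality, and oscillatory
  integrals*, Princeton (1993), Ch. V, pp. 204–211 (singular integrals on `L^p_w`, `w ∈ A_p`) —
  Tsai's [St2] [SteinHA1993].
* E. M. Stein, *Singular integrals and differentiability properties of functions*, Princeton
  (1970), Ch. III §1 (the Riesz transforms) — Tsai's [St1] [Stein1971].
-/

noncomputable section

open MeasureTheory
open scoped ENNReal NNReal

namespace Literature.Analysis.FluidPDE

/-- Local notation for physical space `ℝ³ = EuclideanSpace ℝ (Fin 3)`. -/
local notation "ℝ³" => EuclideanSpace ℝ (Fin 3)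

/-- **Tsai 1998, §4, pp. 45–46 (the weighted `L^{5/3}` pressure of a self-similar profile; the
construction preceding Lemma 4.1).** "It is well known (and easily verified) that `w(y) = |y|^{-5/3}`
is an `A_{5/3}` weight in `ℝ³` … Using the results in [St2, pp. 204–211], we see that the
operators `RᵢRⱼ` used in (2.2) to define `P̃` are continuous on `L^{5/3}_w(ℝ³)` … Therefore,
given `U` satisfying (4.3) [`∫ |U|^{10/3} w dy < ∞`], we can set `P̃ = Σ RᵢRⱼ(UᵢUⱼ)` and we have
`‖P̃‖_{w,5/3} ≤ C Σ ‖UᵢUⱼ‖_{w,5/3}`. Now, following the proof of Lemma 2.1, we want to show that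
`P̃` differs from `P` only by a constant. … This shows that `P̃` together with `U` satisfy
Leray's equation (1.3)." Rendered for the tree's pointwise profile class and with `P̃`
eliminated (module docstring): there is an absolute constant `C` such that for `ν > 0`, `a > 0`
and every Leray profile `(U, P)` on `ℝ³` (`IsLerayProfile ν a U P`) satisfying (4.3),
`∫ |U(y)|^{10/3} |y|^{-5/3} dy < ∞`, there is a constant `c ∈ ℝ` (namely `P − c = P̃`) with
`∫ |P(y) − c|^{5/3} |y|^{-5/3} dy ≤ C ∫ |U(y)|^{10/3} |y|^{-5/3} dy` (in particular
`P − c ∈ L^{5/3}_w`). The printed proof needs the `A_p`-weighted Calderón–Zygmund theory of the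
Riesz transforms (Stein 1993, Ch. V), Weyl's lemma and the Liouville-type argument of Lemma 2.1;
none is in Mathlib — named fact.
[cite: Tsai1998, §4 pp. 45–46 (construction of P̃ before Lemma 4.1)] -/
def tsai1998_pressure_L53w : Prop :=
  ∃ C : ℝ≥0, ∀ ⦃ν a : ℝ⦄, 0 < ν → 0 < a → ∀ ⦃U : ℝ³ → ℝ³⦄ ⦃P : ℝ³ → ℝ⦄,
    FluidPDE.IsLerayProfile ν a U P →
    ∫⁻ y, ‖U y‖ₑ ^ (10 / 3 : ℝ) * ‖y‖ₑ ^ (-(5 / 3) : ℝ) < ∞ →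
    ∃ c : ℝ, ∫⁻ y, ‖P y - c‖ₑ ^ (5 / 3 : ℝ) * ‖y‖ₑ ^ (-(5 / 3) : ℝ) ≤
      C * ∫⁻ y, ‖U y‖ₑ ^ (10 / 3 : ℝ) * ‖y‖ₑ ^ (-(5 / 3) : ℝ)

/-- The qualitative consequence used by Lemma 4.1: under `tsai1998_pressure_L53w`, a Leray
profile with (4.3) has a constant `c` with `P − c ∈ L^{5/3}_w`, `w = |y|^{-5/3}`
(Tsai 1998, p. 46: "`p ∈ L^{5/3}(Q₁)` since `P̃ ∈ L^{5/3}_w`"). [cite: Tsai1998, §4 p. 46] -/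
theorem tsai1998_pressure_L53w.exists_sub_const_lt_top (h : tsai1998_pressure_L53w) {ν a : ℝ}
    (hν : 0 < ν) (ha : 0 < a) {U : ℝ³ → ℝ³} {P : ℝ³ → ℝ} (hprof : FluidPDE.IsLerayProfile ν a U P)
    (hU : ∫⁻ y, ‖U y‖ₑ ^ (10 / 3 : ℝ) * ‖y‖ₑ ^ (-(5 / 3) : ℝ) < ∞) :
    ∃ c : ℝ, ∫⁻ y, ‖P y - c‖ₑ ^ (5 / 3 : ℝ) * ‖y‖ₑ ^ (-(5 / 3) : ℝ) < ∞ := by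
  obtain ⟨C, hC⟩ := h
  obtain ⟨c, hc⟩ := hC hν ha hprof hU
  exact ⟨c, hc.trans_lt (ENNReal.mul_lt_top ENNReal.coe_lt_top hU)⟩

end Literature.Analysis.FluidPDE

end
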